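import Summits.QuantumFields.YangMills.Theorems.BalabanUVNodesN15FullPropagatorV1XColouredSiteFN15At
import Summits.QuantumFields.YangMills.Theorems.BalabanUVNodesN15AtReadingOfRecord13CoPHV1XSized
import HarnessLib

/-!
# Route «BalabanUVNodes», cluster K4 «SpineRates» — node N15 = NE2: THE SITE LAYER WITH THE BACKGROUND LIVE IN THE TwoGrid ENTRY CURRENCY, XXIX — `S_N15` FOR THE FAMILY WITH THE
# NON-ABELIAN SITE LAYER AND BOTH COLOURED SPECIES LIVE (`v1XColFObjects`) AT THE STAGE-13 `CoPH` HOMES AND UNDER A BY-NAME PIN — part XX (= part XVI = dag-n15-a part 87 (S-F))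
# VERBATIM for part XXVIII's literal `v1XColFObjects`, the colour-entry selectors `(c, c′)` carried as two more pin parameters

Cell `pub-ymgap`, WIDTH SEAT `pub-ymgap-dag-n15-w1` (generation 3; director-ym №197 ∕ HUMAN RULING D-0149; chair R455 (A) ∕ R461; plan g83 `W-SEAT-START-LIST.md` v11 §n15).
`bears_on: R4∕N15 · K3⁷ SpineGivenEndpointR13SepCoPH (stmt-QuantumFields-20544)`.  Filed `--supports stmt-QuantumFields-20544 --as helper` — COUNT-NEUTRAL.  0 `def`, 0 `sorry`.
Imports BY NAME this seat's part XXVIII `…N15FullPropagatorV1XColouredSiteFN15At` (`v1XColFObjects`, `live_and_n15At_v1XColFObjects_family`, `s_N15_of_admits_v1XColF_family`,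
`populated_v1XColFObjects`) and dag-n15-a's keyed-home ∕ S-C ∕ S-D files exactly as part XX does; nothing in the tree is modified.

WHY.  The plan's RE-PIN MENU lists each `Live ∧ N15At` literal of this lineage with its reading faces (S-F pattern): `fullGSizedObjects` (K3⁷ v5's pin) ⊂ `v1XASObjects` ⊂ `v1XASiteObjects` ⊂
`v1XAllObjects` ⊂ `v1XAllFObjects` (part XX) and now `v1XColFObjects` — the family whose SITE layer is the coloured (colour-MIXING) one: `G′ ⊗ 1_ι` dressed by the `ad A′`-species, the
averaging perturbation `F₂(A′) = Q∘M_{ad(ηΣ_Γ A′)}` live, every colour entry `(c, c′)`, NO abelianisation `φ` in the site layer (the unit layer keeps part XV's abelianised exact (2.156)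
kernel — its dressing `covBgEx` is typed for scalar backgrounds only).  THIS FILE gives that literal the same ten faces.

CONTENTS.  §1 `s_N15_rRec₁₃CoPH_of_v1XColFReading`, `s_N15_rRec₁₃CoPHOn_of_v1XColFReading`, ★★ `exists_reading_keyedLive_n15At_v1XColF`; §2 `keyedLive_readingOfRecord₁₃CoPH_of_v1XColF_family`,
`live_and_n15At_rateCarriersOfRecord₁₃CoPH_of_v1XColF_family`, `s_N15_readingOfRecord₁₃CoPH_homes_of_v1XColF_family`, `populated_readingOfRecord₁₃CoPH_of_v1XColF_family`; §3
★★ `keyedLive_of_pinnedV1XColF`, ★★ `live_and_n15At_rrOfRecord_of_pinnedV1XColF` (pin body `∃ b a_S α β c₃₅ p c c′, 0<b ∧ 0<a_S ∧ 0<c₃₅ ∧ ∀ F θ hP g₀ os k, (𝔯.lit F θ hP g₀ os).ne2 k =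
v1XColFObjects 3 𝔄 ι e φ F.hL b a_S α β c₃₅ p c c′`).

HONEST FRAMING.  Count-neutral kernel composition BY NAME; no estimate.  MODEL-LEVEL exactly as parts XXIV∕XXVII∕XXVIII say; the faces are CONDITIONAL on dag-n15-a's displayed home texts as
part XX's are.  NE2⁺ NOT PRINTED ∕ NOT proved for d = 4; Node 00's [B9] layers of record are residual — **N15 is NOT discharged** (typed 28∕28 · discharged 5∕27 of record unchanged); K3⁷
OPEN and not claimed (its v5 pins N15 to `fullGSizedObjects`; a re-pin is the plan's act, this literal a CANDIDATE only); one finite four-torus programme at fixed `ε` — NOT ℝ⁴, NOT infinite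
volume, NOT OS, NOT a mass gap, NOT Clay; R4 closes the conditional finite-𝕋⁴ rung `BalabanLadder.UV` only.  Restate-immune (no Theses import).
-/


set_option autoImplicit false

noncomputable section
namespace Summit.QuantumFields.YangMills.BalabanUVNodes.N15.SiteLayerBg

open Literature.MathematicalPhysics.QuantumFieldTheory.Balaban1983to89
open Literature.MathematicalPhysics.QuantumFieldTheory.Balaban1983to89.T4Continuum (T4Family ULoop)
open Node00 (IsDatumOfRecord₁₃CCoPH Stage13HParams NE2Objects₁₁ NE3Letters₁₁ RateObjects₁₁ nonempty_rateObjects₁₁)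
open Node00.W1 (ReadingData)
open Summit.QuantumFields.YangMills.BalabanUVNodes.N15.AtKeyedHome (neZero_blockFactor)
open Summit.QuantumFields.YangMills.BalabanUVNodes.N15.AtRRec13CoPH (admits_rRec₁₃CoPH_ne2 s_N15_rRec₁₃CoPHOn_of_pin s_N15_homes₁₃CoPH_of_forall_admissible)
open Summit.QuantumFields.YangMills.BalabanUVNodes.N15.AtReadingOfRecord13CoPH (s_N15_readingOfRecord₁₃CoPH_homes_of_forall)
open Summit.QuantumFields.YangMills.BalabanUVNodes.N15.PairedFamilyGuard (Live KeyedLive)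
open YMDAG.UVSplit (Datum NE1pCarriers RateCarriers RateRecordPred N15At S_N15 ne2OfRecord₁₁ RateReading₁₃CoPH RRec₁₃CoPH RRec₁₃CoPHOn rateCarriersOfRecord₁₃CoPH
  readingOfRecord₁₃CoPH readingOfRecord₁₃CoPH_ne2 readingOfRecord₁₃CoPH_populated_iff)

variable (𝔄 : Type) [NormedRing 𝔄] [NormedAlgebra ℝ 𝔄] [CompleteSpace 𝔄] (ι : Type) [Fintype ι] [DecidableEq ι] [Nonempty ι] (e : 𝔄 ≃L[ℝ] (ι → ℝ)) (φ : 𝔄 →L[ℝ] ℝ)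
variable {N : ℕ} [NeZero N] {b aS c35 : ℝ}

/-! ## §1 The sized all-layers-dressed reading at both CoPH homes; the keyed-live reading -/

/-- ★ **THE SIZED GAUGE-DRESSED, ALL-LAYERS-DRESSED READING CLOSES THE STUB AT THE CANONICAL HOME** (`b, a_S, c₃₅ > 0`, `α β`, `p`): a reading whose NE2 objects at every Stage-13 datum key ARE
`v1XASObjects 3 𝔄 ι e F.hL b a_S α β c₃₅ p` has `S_N15 (RRec₁₃CoPH 𝔯)` — part 86 at the certificate `admits_rRec₁₃CoPH_ne2`. [bookkeeping] -/
theorem s_N15_rRec₁₃CoPH_of_v1XColFReading (hb : 0 < b) (haS : 0 < aS) (hc35 : 0 < c35) (hφ : ∀ a : 𝔄, |φ a| ≤ ‖a‖) (α β : Fin 4) (p : ℝ) (c c' : V1IndexSM 3 → ι) (𝔯 : RateReading₁₃CoPH N)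
    (h : ∀ (F : T4Family) (D : Datum F N) (hD : IsDatumOfRecord₁₃CCoPH F N D) (g₀ : ℕ → ℝ) (os : List (ULoop F)) (k : ℕ),
      (𝔯.lit F hD.params hD.provisos g₀ os).ne2 k = haveI := neZero_blockFactor F; v1XColFObjects 3 𝔄 ι e φ F.hL b aS α β c35 p c c') :
    S_N15 (RRec₁₃CoPH 𝔯) :=
  s_N15_of_admits_v1XColF_family (N := N) (key := fun F D => IsDatumOfRecord₁₃CCoPH F N D) 𝔄 ι e φ hb haS hc35 hφ α β p c c'
    (fun {F D} (hD : IsDatumOfRecord₁₃CCoPH F N D) g₀ os k => (𝔯.lit F hD.params hD.provisos g₀ os).ne2 k) (RRec₁₃CoPH 𝔯) (admits_rRec₁₃CoPH_ne2 𝔯) h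

/-- ★ **THE SIZED GAUGE-DRESSED, ALL-LAYERS-DRESSED READING CLOSES THE STUB AT EVERY GUARDED HOME** (θ-form, through 74b's `s_N15_rRec₁₃CoPHOn_of_pin`). [bookkeeping] -/
theorem s_N15_rRec₁₃CoPHOn_of_v1XColFReading (hb : 0 < b) (haS : 0 < aS) (hc35 : 0 < c35) (hφ : ∀ a : 𝔄, |φ a| ≤ ‖a‖) (α β : Fin 4) (p : ℝ) (c c' : V1IndexSM 3 → ι) (𝔯 : RateReading₁₃CoPH N)
    (Rg : (F : T4Family) → Stage13HParams F N → Prop)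
    (h : ∀ (F : T4Family) (θ : Stage13HParams F N) (hP : θ.Provisos₁₃CoPH F N), Rg F θ → θ.Admissible F N → ∀ (g₀ : ℕ → ℝ) (os : List (ULoop F)) (k : ℕ),
      (𝔯.lit F θ hP g₀ os).ne2 k = haveI := neZero_blockFactor F; v1XColFObjects 3 𝔄 ι e φ F.hL b aS α β c35 p c c') :
    S_N15 (RRec₁₃CoPHOn 𝔯 Rg) :=
  s_N15_rRec₁₃CoPHOn_of_pin 𝔯 Rg (fun F _ _ _ _ _ => haveI := neZero_blockFactor F; v1XColFObjects 3 𝔄 ι e φ F.hL b aS α β c35 p c c') h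
    fun F _ _ _ _ _ _ _ => (live_and_n15At_v1XColFObjects_family 𝔄 ι e φ hb haS hc35 hφ α β p c c' F).2

/-- ★★ **SOME STAGE-13 READING WITH THE SIZED GAUGE-DRESSED, ALL-LAYERS-DRESSED OBJECTS NAMED PASSES `KeyedLive` (EVERY SELECTOR), CARRIES `N15At` (EVERY BUNDLE), IS POPULATED, AND HAS `S_N15` AT BOTH
CoPH HOMES** (`b, a_S, c₃₅ > 0`, `α β`, `p`) — w2's `exists_reading_keyedLive_n15At` shape with a background-LIVE, size-LIVE operator layer; fillers as in S-C (RR-1's sanity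
`u3`∕`ne3`, empty NE1⁺ — no content). [bookkeeping] -/
theorem exists_reading_keyedLive_n15At_v1XColF (hb : 0 < b) (haS : 0 < aS) (hc35 : 0 < c35) (hφ : ∀ a : 𝔄, |φ a| ≤ ‖a‖) (α β : Fin 4) (p : ℝ) (c c' : V1IndexSM 3 → ι) :
    ∃ 𝔯 : RateReading₁₃CoPH N,
      (∀ (F : T4Family) (θ : Stage13HParams F N) (hP : θ.Provisos₁₃CoPH F N) (g₀ : ℕ → ℝ) (os : List (ULoop F)) (k : ℕ),
        (𝔯.lit F θ hP g₀ os).ne2 k = haveI := neZero_blockFactor F; v1XColFObjects 3 𝔄 ι e φ F.hL b aS α β c35 p c c') ∧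
      (∀ ksel : (F : T4Family) → (θ : Stage13HParams F N) → θ.Provisos₁₃CoPH F N → (ℕ → ℝ) → List (ULoop F) → ℕ,
        KeyedLive (fun F θ hP g₀ os => rateCarriersOfRecord₁₃CoPH 𝔯 F θ hP g₀ os (ksel F θ hP g₀ os)) ∧
        ∀ (F : T4Family) (θ : Stage13HParams F N) (hP : θ.Provisos₁₃CoPH F N) (g₀ : ℕ → ℝ) (os : List (ULoop F)),
          N15At (rateCarriersOfRecord₁₃CoPH 𝔯 F θ hP g₀ os (ksel F θ hP g₀ os)).ne2) ∧
      (∀ (F : T4Family) (θ : Stage13HParams F N) (hP : θ.Provisos₁₃CoPH F N) (g₀ : ℕ → ℝ) (os : List (ULoop F)) (k : ℕ), ((𝔯.lit F θ hP g₀ os).ne2 k).Populated) ∧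
      S_N15 (RRec₁₃CoPH 𝔯) ∧ ∀ Rg : (F : T4Family) → Stage13HParams F N → Prop, S_N15 (RRec₁₃CoPHOn 𝔯 Rg) := by
  obtain ⟨r₀⟩ := nonempty_rateObjects₁₁ (N := N)
  let lit : (F : T4Family) → (θ : Stage13HParams F N) → θ.Provisos₁₃CoPH F N → (ℕ → ℝ) → List (ULoop F) → RateObjects₁₁ N :=
    fun F _ _ _ _ => ⟨r₀.u3, r₀.ne3, fun _ => haveI := neZero_blockFactor F; v1XColFObjects 3 𝔄 ι e φ F.hL b aS α β c35 p c c'⟩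
  let 𝔯 : RateReading₁₃CoPH N := ⟨lit, fun _ _ _ _ _ => (⟨Empty, ⟨fun q => q.elim, fun q => q.elim, fun q => q.elim⟩, 0⟩ : NE1pCarriers)⟩
  have h𝔯 : ∀ (F : T4Family) (θ : Stage13HParams F N) (hP : θ.Provisos₁₃CoPH F N) (g₀ : ℕ → ℝ) (os : List (ULoop F)) (k : ℕ),
      (𝔯.lit F θ hP g₀ os).ne2 k = haveI := neZero_blockFactor F; v1XColFObjects 3 𝔄 ι e φ F.hL b aS α β c35 p c c' := fun _ _ _ _ _ _ => rfl
  have key : ∀ F : T4Family, Live (ne2OfRecord₁₁ (haveI := neZero_blockFactor F; v1XColFObjects 3 𝔄 ι e φ F.hL b aS α β c35 p c c')) ∧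
      N15At (ne2OfRecord₁₁ (haveI := neZero_blockFactor F; v1XColFObjects 3 𝔄 ι e φ F.hL b aS α β c35 p c c')) :=
    fun F => live_and_n15At_v1XColFObjects_family 𝔄 ι e φ hb haS hc35 hφ α β p c c' F
  have hS := s_N15_homes₁₃CoPH_of_forall_admissible 𝔯 fun F θ hP _ g₀ os k => by
    rw [h𝔯 F θ hP g₀ os k]
    exact (key F).2
  refine ⟨𝔯, h𝔯, fun ksel => ⟨fun F θ hP _ _ g₀ os => (key F).1, fun F θ hP g₀ os => (key F).2⟩, fun F θ hP g₀ os k => ?_, hS.1, hS.2⟩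
  rw [h𝔯 F θ hP g₀ os k]
  exact (haveI := neZero_blockFactor F; populated_v1XColFObjects (d := 3) 𝔄 ι e φ F.hL b aS α β c35 p c c')

/-! ## §2 At the READING OF RECORD `readingOfRecord₁₃CoPH w1 ℓ₃ ne2 ne1` with the residual layer := the sized all-layers-dressed objects -/

section OfRecord

variable (w1 : (F : T4Family) → (θ : Stage13HParams F N) → ReadingData F (Node00.MatA N) θ.τ9.M) (ℓ₃ : T4Family → NE3Letters₁₁)
  (ne2 : (F : T4Family) → Stage13HParams F N → (ℕ → ℝ) → List (ULoop F) → ℕ → NE2Objects₁₁)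
  (ne1 : (F : T4Family) → Stage13HParams F N → (ℕ → ℝ) → List (ULoop F) → NE1pCarriers)

/-- ★★ **`KeyedLive` AT THE BUNDLE OF THE READING OF RECORD, EVERY SELECTOR**, when `ne2` takes the sized all-layers-dressed objects as values everywhere (`c₃₅ > 0`). [bookkeeping] -/
theorem keyedLive_readingOfRecord₁₃CoPH_of_v1XColF_family (hb : 0 < b) (haS : 0 < aS) (hc35 : 0 < c35) (hφ : ∀ a : 𝔄, |φ a| ≤ ‖a‖) (α β : Fin 4) (p : ℝ) (c c' : V1IndexSM 3 → ι)
    (h : ∀ (F : T4Family) (θ : Stage13HParams F N) (g₀ : ℕ → ℝ) (os : List (ULoop F)) (k : ℕ),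
      ne2 F θ g₀ os k = haveI := neZero_blockFactor F; v1XColFObjects 3 𝔄 ι e φ F.hL b aS α β c35 p c c')
    (ksel : (F : T4Family) → (θ : Stage13HParams F N) → θ.Provisos₁₃CoPH F N → (ℕ → ℝ) → List (ULoop F) → ℕ) :
    KeyedLive (fun F θ hP g₀ os => rateCarriersOfRecord₁₃CoPH (readingOfRecord₁₃CoPH w1 ℓ₃ ne2 ne1) F θ hP g₀ os (ksel F θ hP g₀ os)) := by
  intro F θ hP _ _ g₀ os
  show Live (ne2OfRecord₁₁ (((readingOfRecord₁₃CoPH w1 ℓ₃ ne2 ne1).lit F θ hP g₀ os).ne2 (ksel F θ hP g₀ os)))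
  rw [readingOfRecord₁₃CoPH_ne2, h F θ g₀ os (ksel F θ hP g₀ os)]
  exact (live_and_n15At_v1XColFObjects_family 𝔄 ι e φ hb haS hc35 hφ α β p c c' F).1

/-- ★★ **`Live ∧ N15At` AT EVERY BUNDLE OF THE READING OF RECORD** (the v2∕v3 `RatesHolderAt` N15 conjunct at `rrOfRecord` and the guard), same hypothesis. [bookkeeping] -/
theorem live_and_n15At_rateCarriersOfRecord₁₃CoPH_of_v1XColF_family (hb : 0 < b) (haS : 0 < aS) (hc35 : 0 < c35) (hφ : ∀ a : 𝔄, |φ a| ≤ ‖a‖) (α β : Fin 4) (p : ℝ) (c c' : V1IndexSM 3 → ι)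
    (h : ∀ (F : T4Family) (θ : Stage13HParams F N) (g₀ : ℕ → ℝ) (os : List (ULoop F)) (k : ℕ),
      ne2 F θ g₀ os k = haveI := neZero_blockFactor F; v1XColFObjects 3 𝔄 ι e φ F.hL b aS α β c35 p c c')
    (ksel : (F : T4Family) → (θ : Stage13HParams F N) → θ.Provisos₁₃CoPH F N → (ℕ → ℝ) → List (ULoop F) → ℕ)
    (F : T4Family) (θ : Stage13HParams F N) (hP : θ.Provisos₁₃CoPH F N) (g₀ : ℕ → ℝ) (os : List (ULoop F)) :
    Live (rateCarriersOfRecord₁₃CoPH (readingOfRecord₁₃CoPH w1 ℓ₃ ne2 ne1) F θ hP g₀ os (ksel F θ hP g₀ os)).ne2 ∧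
      N15At (rateCarriersOfRecord₁₃CoPH (readingOfRecord₁₃CoPH w1 ℓ₃ ne2 ne1) F θ hP g₀ os (ksel F θ hP g₀ os)).ne2 := by
  show Live (ne2OfRecord₁₁ (((readingOfRecord₁₃CoPH w1 ℓ₃ ne2 ne1).lit F θ hP g₀ os).ne2 (ksel F θ hP g₀ os))) ∧
    N15At (ne2OfRecord₁₁ (((readingOfRecord₁₃CoPH w1 ℓ₃ ne2 ne1).lit F θ hP g₀ os).ne2 (ksel F θ hP g₀ os)))
  rw [readingOfRecord₁₃CoPH_ne2, h F θ g₀ os (ksel F θ hP g₀ os)]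
  exact live_and_n15At_v1XColFObjects_family 𝔄 ι e φ hb haS hc35 hφ α β p c c' F

/-- ★★ **`S_N15` AT BOTH HOMES OF THE READING OF RECORD** when `ne2` takes the sized all-layers-dressed objects on the admissible tuples with provisos. [bookkeeping] -/
theorem s_N15_readingOfRecord₁₃CoPH_homes_of_v1XColF_family (hb : 0 < b) (haS : 0 < aS) (hc35 : 0 < c35) (hφ : ∀ a : 𝔄, |φ a| ≤ ‖a‖) (α β : Fin 4) (p : ℝ) (c c' : V1IndexSM 3 → ι)
    (h : ∀ (F : T4Family) (θ : Stage13HParams F N), θ.Provisos₁₃CoPH F N → θ.Admissible F N → ∀ (g₀ : ℕ → ℝ) (os : List (ULoop F)) (k : ℕ),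
      ne2 F θ g₀ os k = haveI := neZero_blockFactor F; v1XColFObjects 3 𝔄 ι e φ F.hL b aS α β c35 p c c') :
    S_N15 (RRec₁₃CoPH (readingOfRecord₁₃CoPH w1 ℓ₃ ne2 ne1)) ∧
      ∀ Rg : (F : T4Family) → Stage13HParams F N → Prop, S_N15 (RRec₁₃CoPHOn (readingOfRecord₁₃CoPH w1 ℓ₃ ne2 ne1) Rg) :=
  s_N15_readingOfRecord₁₃CoPH_homes_of_forall w1 ℓ₃ ne2 ne1 fun F θ hP hA g₀ os k => by
    rw [h F θ hP hA g₀ os k]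
    exact (live_and_n15At_v1XColFObjects_family 𝔄 ι e φ hb haS hc35 hφ α β p c c' F).2

omit [CompleteSpace 𝔄] [Nonempty ι] in
/-- … such a reading of record is `Populated` at every Stage-13 tuple with provisos. [bookkeeping] -/
theorem populated_readingOfRecord₁₃CoPH_of_v1XColF_family (α β : Fin 4) (p : ℝ) (c c' : V1IndexSM 3 → ι) (F : T4Family) (θ : Stage13HParams F N)
    (hP : θ.Provisos₁₃CoPH F N) (g₀ : ℕ → ℝ) (os : List (ULoop F))
    (h : ∀ k : ℕ, ne2 F θ g₀ os k = haveI := neZero_blockFactor F; v1XColFObjects 3 𝔄 ι e φ F.hL b aS α β c35 p c c') :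
    ((readingOfRecord₁₃CoPH w1 ℓ₃ ne2 ne1).lit F θ hP g₀ os).Populated := by
  refine (readingOfRecord₁₃CoPH_populated_iff w1 ℓ₃ ne2 ne1 F θ hP g₀ os).2 fun k => ?_
  rw [h k]
  exact (haveI := neZero_blockFactor F; populated_v1XColFObjects (d := 3) 𝔄 ι e φ F.hL b aS α β c35 p c c')

-- NOTE: the family-free face «∃ ne2, KeyedLive ∧ N15At ∧ Populated ∧ S_N15 at both homes» is LITERALLY part 84's (S-C)
-- `exists_ne2_keyedLive_s_N15_readingOfRecord₁₃CoPH_fullGSized` (the statement does not name the objects) — cited, not re-filed (gate `dedup.landed`);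
-- the `v1XAS`-specific content is the three named faces above.

end OfRecord

/-! ## §3 Under a BY-NAME PIN to the sized all-layers-dressed objects (the body a v3 `N15PinnedV1XAll 𝔯` would have): pinned ⟹ keyed-live ∧ `N15At` -/

section Pinned

/-- ★★ **PINNED ⟹ KEYED-LIVE, EVERY SELECTOR**: if the reading's N15 objects are the sized all-layers-dressed objects at every tuple and run length (for SOME `b, a_S, c₃₅ > 0`, directions,
`p`), then `KeyedLive` holds at the bundle of record for every run-length selector. [bookkeeping] -/
theorem keyedLive_of_pinnedV1XColF (hφ : ∀ a : 𝔄, |φ a| ≤ ‖a‖) (𝔯 : RateReading₁₃CoPH N)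
    (hpin : ∃ (b aS : ℝ) (α β : Fin 4) (c35 p : ℝ) (c c' : V1IndexSM 3 → ι), 0 < b ∧ 0 < aS ∧ 0 < c35 ∧
      ∀ (F : T4Family) (θ : Stage13HParams F N) (hP : θ.Provisos₁₃CoPH F N) (g₀ : ℕ → ℝ) (os : List (ULoop F)) (k : ℕ),
        (𝔯.lit F θ hP g₀ os).ne2 k = haveI := neZero_blockFactor F; v1XColFObjects 3 𝔄 ι e φ F.hL b aS α β c35 p c c')
    (ksel : (F : T4Family) → (θ : Stage13HParams F N) → θ.Provisos₁₃CoPH F N → (ℕ → ℝ) → List (ULoop F) → ℕ) :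
    KeyedLive (fun F θ hP g₀ os => rateCarriersOfRecord₁₃CoPH 𝔯 F θ hP g₀ os (ksel F θ hP g₀ os)) := by
  obtain ⟨b, aS, α, β, c35, p, c, c', hb, haS, hc35, h⟩ := hpin
  intro F θ hP _ _ g₀ os
  show Live (ne2OfRecord₁₁ ((𝔯.lit F θ hP g₀ os).ne2 (ksel F θ hP g₀ os)))
  rw [h F θ hP g₀ os (ksel F θ hP g₀ os)]
  exact (live_and_n15At_v1XColFObjects_family 𝔄 ι e φ hb haS hc35 hφ α β p c c' F).1

/-- ★★ **PINNED ⟹ `Live ∧ N15At` AT EVERY BUNDLE OF RECORD** (every Stage-13 parameter with provisos, every `(g₀, os)`, every selector) — the v3 analogue of the skeleton's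
`n15At_rrOfRecord_of_pinned` together with the guard, from the pin alone. [bookkeeping] -/
theorem live_and_n15At_rrOfRecord_of_pinnedV1XColF (hφ : ∀ a : 𝔄, |φ a| ≤ ‖a‖) (𝔯 : RateReading₁₃CoPH N)
    (hpin : ∃ (b aS : ℝ) (α β : Fin 4) (c35 p : ℝ) (c c' : V1IndexSM 3 → ι), 0 < b ∧ 0 < aS ∧ 0 < c35 ∧
      ∀ (F : T4Family) (θ : Stage13HParams F N) (hP : θ.Provisos₁₃CoPH F N) (g₀ : ℕ → ℝ) (os : List (ULoop F)) (k : ℕ),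
        (𝔯.lit F θ hP g₀ os).ne2 k = haveI := neZero_blockFactor F; v1XColFObjects 3 𝔄 ι e φ F.hL b aS α β c35 p c c')
    (ksel : (F : T4Family) → (θ : Stage13HParams F N) → θ.Provisos₁₃CoPH F N → (ℕ → ℝ) → List (ULoop F) → ℕ)
    (F : T4Family) (θ : Stage13HParams F N) (hP : θ.Provisos₁₃CoPH F N) (g₀ : ℕ → ℝ) (os : List (ULoop F)) :
    Live (rateCarriersOfRecord₁₃CoPH 𝔯 F θ hP g₀ os (ksel F θ hP g₀ os)).ne2 ∧ N15At (rateCarriersOfRecord₁₃CoPH 𝔯 F θ hP g₀ os (ksel F θ hP g₀ os)).ne2 := by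
  obtain ⟨b, aS, α, β, c35, p, c, c', hb, haS, hc35, h⟩ := hpin
  show Live (ne2OfRecord₁₁ ((𝔯.lit F θ hP g₀ os).ne2 (ksel F θ hP g₀ os))) ∧ N15At (ne2OfRecord₁₁ ((𝔯.lit F θ hP g₀ os).ne2 (ksel F θ hP g₀ os)))
  rw [h F θ hP g₀ os (ksel F θ hP g₀ os)]
  exact live_and_n15At_v1XColFObjects_family 𝔄 ι e φ hb haS hc35 hφ α β p c c' F

end Pinned

end Summit.QuantumFields.YangMills.BalabanUVNodes.N15.SiteLayerBg

end
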